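import Literature.NumberTheory.GaloisRepresentations.InertiaCohomologyTorsionBound
import Summits.BirchSwinnertonDyer.BirchSwinnertonDyer.Theorems.EisensteinPrimesBSDpOnCellCTelescopeK2HOneFiniteKernel
import HarnessLib

/-!
# Crux 4 `BSDpOnCellC` (stmt-BirchSwinnertonDyer-19034), line «telescope» v10, leaf N2|pub sub-leaf W2 / leaf N3′ — the (ann) input, fourth brick:
# `H¹(I_F, D)[p]` IS FINITE for a discrete `Γ_F`-module `D` QUASI-ISOMORPHIC to a `p`-divisible one with finite `p`-torsion
# (successor LEAD `cruxlead-19034` g3; `--supports`, helper; THEOREMS ONLY; generic over a non-archimedean local field `F`; closes no registered stub)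

HONEST FRAMING. No registered stub, no crux, no summit statement is proved; BSD is proved for no curve. N1's (fd₀) gives an additive,
Galois-equivariant `θ₀ : A₂[X] → E[p^∞]` with finite kernel and cokernel; `E[p^∞]` is `p`-divisible with finite `p`-torsion, so the tree's
`finite_torsionBy_continuousCohomology_one_absInertia` applies to IT, not to `A₂[X]`. This file transports the finiteness of the `p`-torsion
of `H¹(I_F, ·)` back along such a quasi-isomorphism, using the finite-kernel dévissage `TelescopeK2HOneFiniteKernel.finite_setOf_cohomologyMap_one_eq_zero`
and the finiteness of `H¹(I_F, B)` for finite `B` of order prime to the residue characteristic (`natCard_continuousCohomology_one_absInertia_le`).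

* `natCard_coprime_of_forall_pow_smul_eq_zero` — a finite `p`-primary abelian group has order prime to every prime `ℓ ≠ p` (Cauchy).
* **`finite_setOf_smul_eq_zero_h1_absInertia_of_hom`** — `ρD, ρE : Γ_F → Aut(D), Aut(E)` discrete over `ℤ`, `f : D → E` equivariant with
  finite kernel and finite cokernel, `D` `p`-primary, `E` `p`-divisible with `E[p]` finite, `p ≠` residue characteristic: the set
  `H¹(I_F, D)[p]` is finite.

References: J.-P. Serre, Cohomologie galoisienne, I §2.2 [SerreGaloisCohomology1997]; J. Milne, Arithmetic Duality Theorems, I §2 Lemma 2.9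
[MilneADT2006]; R. Greenberg–V. Vatsal, Invent. Math. 142 (2000) §2 Prop. 2.4 [GreenbergVatsal2000].
-/

set_option autoImplicit false
set_option linter.dupNamespace false

noncomputable section

open CategoryTheory Function
open scoped Pointwise Valued
open Field ValuativeRel

universe u

open Literature.NumberTheory.GaloisRepresentations Literature.NumberTheory.GaloisRepresentations.IsNonarchimedeanLocalField

namespace Summit.BirchSwinnertonDyer.BirchSwinnertonDyer.Theorems.TelescopeK2HOneInertiaQuasiIso

/-- A finite abelian group in which every element is killed by a power of the prime `p` has order prime to every prime `ℓ ≠ p`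
(Cauchy's theorem). [folklore] -/
theorem natCard_coprime_of_forall_pow_smul_eq_zero {B : Type*} [AddCommGroup B] [Finite B] {p ℓ : ℕ} (hp : p.Prime)
    (hℓ : ℓ.Prime) (hne : p ≠ ℓ) (hB : ∀ b : B, ∃ k : ℕ, p ^ k • b = 0) : (Nat.card B).Coprime ℓ := by
  rw [Nat.Coprime, Nat.gcd_comm]
  refine Nat.coprime_of_dvd fun q hq hqℓ hqB => ?_
  have hq' : q = ℓ := (Nat.prime_dvd_prime_iff_eq hq hℓ).mp hqℓ
  subst hq'
  haveI : Fact q.Prime := ⟨hq⟩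
  obtain ⟨b, hb⟩ := exists_prime_addOrderOf_dvd_card' (G := B) q hqB
  obtain ⟨k, hk⟩ := hB b
  have hdvd : q ∣ p ^ k := by
    rw [← hb]
    exact addOrderOf_dvd_of_nsmul_eq_zero hk
  exact hne ((Nat.prime_dvd_prime_iff_eq hq hp).mp (hq.dvd_of_dvd_pow hdvd)).symm

variable (F : Type u) [Field F] [ValuativeRel F] [TopologicalSpace F] [IsNonarchimedeanLocalField F]
  {D : Type u} [AddCommGroup D] [TopologicalSpace D] [DiscreteTopology D]
  {E : Type u} [AddCommGroup E] [TopologicalSpace E] [DiscreteTopology E]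

/-- **`H¹(I_F, D)[p]` is finite for `D` quasi-isomorphic to a `p`-divisible module with finite `p`-torsion.** `f : D → E` an equivariant
map of discrete `Γ_F`-modules with FINITE kernel and FINITE cokernel, `D` `p`-primary, `E` `p`-divisible with `E[p]` finite, `p`
different from the residue characteristic of `F`. [cite: SerreGaloisCohomology1997, I §2.2] [cite: MilneADT2006, I §2 Lemma 2.9]
[cite: GreenbergVatsal2000, §2, proof of Prop. 2.4] -/
theorem finite_setOf_smul_eq_zero_h1_absInertia_of_hom (ρD : ContinuousRep (absoluteGaloisGroup F) ℤ D)
    (ρE : ContinuousRep (absoluteGaloisGroup F) ℤ E) (f : ρD.toTopRep ⟶ ρE.toTopRep)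
    (hker : Finite (LinearMap.ker f.hom.toLinearMap)) (hcoker : Finite (E ⧸ LinearMap.range f.hom.toLinearMap))
    {p : ℕ} [Fact p.Prime] (hp : p.Coprime (ringChar 𝓀[F]))
    (hD : ∀ d : D, ∃ k : ℕ, p ^ k • d = 0) (hEdiv : ∀ e : E, ∃ b : E, p • b = e)
    [Finite (Submodule.torsionBy ℤ E (p : ℤ))] :
    Finite (Submodule.torsionBy ℤ
      (continuousCohomology 1 ((ρD.restrict (subgroupIncl (absInertia F))).toTopRep)) (p : ℤ)) := by
  classical
  haveI : CompactSpace (absoluteGaloisGroup F) := absoluteGaloisGroup_compactSpace F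
  haveI : CompactSpace (absInertia F) :=
    isCompact_iff_compactSpace.mp (isClosed_absInertia_holds F).isCompact
  set ρDI := ρD.restrict (subgroupIncl (absInertia F)) with hρDI
  set ρEI := ρE.restrict (subgroupIncl (absInertia F)) with hρEI
  -- `f` restricted to inertia
  let fI : ρDI.toTopRep ⟶ ρEI.toTopRep :=
    TopRep.ofHom ⟨f.hom.toContinuousLinearMap, fun σ => by
      refine ContinuousLinearMap.ext fun m => ?_
      change f.hom (ρD (subgroupIncl (absInertia F) σ) m) = ρE (subgroupIncl (absInertia F) σ) (f.hom m)
      exact ContinuousRep.hom_comm_apply f _ m⟩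
  -- `H¹(I_F, ker f)` is finite: `ker f` is a finite `p`-group, of order prime to the residue characteristic
  have hKst : ∀ g, LinearMap.ker f.hom.toLinearMap ≤ (LinearMap.ker f.hom.toLinearMap).comap (ρD g) :=
    TelescopeK2HOneFiniteKernel.ker_le_comap ρD ρE f
  haveI := hker
  have hℓ : (ringChar 𝓀[F]).Prime := ringChar_residueField_prime (F := F)
  have hpℓ : p ≠ ringChar 𝓀[F] := fun h => by
    rw [h, Nat.coprime_self] at hp
    exact hℓ.one_lt.ne' hp
  have hB : (Nat.card (LinearMap.ker f.hom.toLinearMap)).Coprime (ringChar 𝓀[F]) :=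
    natCard_coprime_of_forall_pow_smul_eq_zero (Fact.out : p.Prime) hℓ hpℓ fun b => by
      obtain ⟨k, hk⟩ := hD (b : D)
      exact ⟨k, Subtype.ext (by rw [AddSubmonoidClass.coe_nsmul, hk, ZeroMemClass.coe_zero])⟩
  have hKfin := (natCard_continuousCohomology_one_absInertia_le F
    (ρD.subrepresentation (LinearMap.ker f.hom.toLinearMap) hKst) hB).1
  have hK : Finite (continuousCohomology 1
      (ρDI.subrepresentation (LinearMap.ker fI.hom.toLinearMap)
        (TelescopeK2HOneFiniteKernel.ker_le_comap ρDI ρEI fI)).toTopRep) := hKfin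
  have hC : Finite (E ⧸ LinearMap.range fI.hom.toLinearMap) := hcoker
  have hS₀ := TelescopeK2HOneFiniteKernel.finite_setOf_cohomologyMap_one_eq_zero ρDI ρEI fI hK hC
  -- `H¹(I_F, E)[p]` is finite (divisible coefficients)
  haveI hEfin := finite_torsionBy_continuousCohomology_one_absInertia F ρE hp (fun e => hEdiv e)
  -- the `p`-torsion of `H¹(I_F, D)` maps into that finite group with finite fibres
  set TD := Submodule.torsionBy ℤ (continuousCohomology 1 ρDI.toTopRep) (p : ℤ) with hTDdef
  set TE := Submodule.torsionBy ℤ (continuousCohomology 1 ρEI.toTopRep) (p : ℤ) with hTEdef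
  set Y : Set (continuousCohomology 1 ρEI.toTopRep) := (TE : Set (continuousCohomology 1 ρEI.toTopRep)) with hYdef
  have hYfin : Y.Finite := Set.toFinite _
  have hval : ∀ x : continuousCohomology 1 ρDI.toTopRep, x ∈ TD → cohomologyMap fI 1 x ∈ Y := by
    intro x hx
    rw [hTDdef, Submodule.mem_torsionBy_iff] at hx
    rw [hYdef, SetLike.mem_coe, hTEdef, Submodule.mem_torsionBy_iff,
      ← (ConcreteCategory.hom (cohomologyMap fI 1)).map_smul, hx, map_zero]
  have hfib : ∀ y ∈ Y, Set.Finite {x : continuousCohomology 1 ρDI.toTopRep | x ∈ TD ∧ cohomologyMap fI 1 x = y} := by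
    intro y _
    by_cases hne : {x : continuousCohomology 1 ρDI.toTopRep | x ∈ TD ∧ cohomologyMap fI 1 x = y}.Nonempty
    · obtain ⟨x₁, -, hx₁y⟩ := hne
      refine ((hS₀.image fun z => x₁ + z)).subset ?_
      rintro x ⟨-, hxy⟩
      refine ⟨x - x₁, ?_, by abel⟩
      change cohomologyMap fI 1 (x - x₁) = 0
      rw [map_sub, hxy, hx₁y, sub_self]
    · rw [Set.not_nonempty_iff_eq_empty] at hne
      rw [hne]
      exact Set.finite_empty
  have hTD : (TD : Set (continuousCohomology 1 ρDI.toTopRep)).Finite := by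
    refine (hYfin.biUnion hfib).subset fun x hx => ?_
    rw [Set.mem_iUnion₂]
    exact ⟨cohomologyMap fI 1 x, hval x hx, hx, rfl⟩
  exact Set.finite_coe_iff.mpr hTD

end Summit.BirchSwinnertonDyer.BirchSwinnertonDyer.Theorems.TelescopeK2HOneInertiaQuasiIso

end
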